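import Literature.Probability.RandomPlanarGeometry.SAWCountMonotoneCutDoubling
import Literature.Probability.RandomPlanarGeometry.SAWCountMonotoneEscape
import HarnessLib

/-!
# Monotonicity `cₙ ≤ cₙ₊₁` (O'Brien 1990): cut-edge doubling combined with the escape injection —
# `cₙ ≤ cₙ₊₁ + #(R ∩ cutFree)`

Joins `SAWCountMonotoneCutDoubling.lean` (doubling the first strict cut edge: `cutDouble`,
`cutDouble_injOn`, `not_cutFree_restrictTo_cutDouble`, the cut-free walks `cutFree d n`) and
`SAWCountMonotoneEscape.lean` (the escape injection `escapeMap`: prolong a free end along an escape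
route, else prepend a free start site; `escapeMap_injOn` outside the escape residual
`R = escapeResidual d n` = doomed end and completely surrounded start) for the door `cₙ ≤ cₙ₊₁`
(O'Brien, *Monotonicity of the number of self-avoiding walks*, J. Stat. Phys. **59** (1990)
969–979, quoted in BDGS 2012 §1.3 and Madras–Slade §7.1 p. 231).

The two injections have DISJOINT images when the doubling is used on the walks with a strict cut
edge and the escape injection on the cut-free ones:

* a prolonged cut-free walk has a cut-free `n`-step prefix, a doubled walk has not
  (`not_cutFree_restrictTo_cutDouble`);
* a doubled walk has a strict cut edge at a time `≥ 1` — the second copy of the doubled edge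
  (`IsUpCut.dblAt_isUpCut_succ`, `exists_hasCutAt_succ_cutDouble`) — whereas prepending a site to
  a cut-free walk creates no strict cut edge except possibly the new first step
  (`not_hasCutAt_succ_prependVia`).

Hence the map "double the first cut edge if there is one, else escape" is injective on all
`n`-step walks outside `R ∩ cutFree d n`, and

* `count_le_count_succ_add_card_escapeResidual_inter_cutFree` :
  **`cₙ ≤ cₙ₊₁ + #(escapeResidual d n ∩ cutFree d n)`** — sharpening both
  `count_le_count_succ_add_card_escapeResidual` (`cₙ ≤ cₙ₊₁ + #R`) and, up to the pocketed ends,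
  `count_le_count_succ_add_card_doublyTrapped_cutFree` (`cₙ ≤ cₙ₊₁ + #(T₂ ∩ cutFree)`);
* `count_le_count_succ_of_escapeResidual_inter_cutFree_eq_empty` : O'Brien's inequality wherever no
  walk of the escape residual is cut-free.

No named facts are introduced. [cite: MadrasSlade1993, §1.1; §7.1 p. 231]
[cite: BDGS2012, §1.3 (`cₙ ≤ cₙ₊₁`, O'Brien 1990)]
-/

noncomputable section

open Literature.Probability.LatticeModels Literature.Probability.Percolation SimpleGraph

namespace Literature.Probability.RandomPlanarGeometry.SAW.Zd

variable {d : ℕ}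

/-! ### A doubled walk has a strict cut edge at a positive time -/

/-- The SECOND copy of a doubled up-cut is again an up-cut of the doubled walk (time `s + 1`,
horizon `n + 1`). [cite: MadrasSlade1993, §7.1] -/
theorem IsUpCut.dblAt_isUpCut_succ {k : Fin d} {s n : ℕ} {ω : ℕ → Site d} (h : IsUpCut k s n ω) :
    IsUpCut k (s + 1) (n + 1) (dblAt k s ω) := by
  obtain ⟨hs, hstep, hpast, hfut⟩ := h
  have hsk : ω (s + 1) k = ω s k + 1 := by rw [hstep]; simp
  refine ⟨by omega, ?_, ?_, ?_⟩
  · rw [dblAt_succ le_rfl, dblAt_of_le le_rfl]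
  · intro i hi
    rw [dblAt_of_le hi, dblAt_of_le le_rfl, hsk]
    rcases Nat.lt_or_ge i (s + 1) with hlt | hge
    · have := hpast i (by omega); omega
    · rw [le_antisymm hi hge, hsk]
  · intro i hi hin
    rw [dblAt_of_le le_rfl, hsk, dblAt_of_lt (by omega), Pi.add_apply, Pi.single_eq_same]
    have := hfut (i - 1) (by omega) (by omega)
    omega

/-- A walk with a strict cut edge, doubled at its first cut edge, has a strict cut edge at some time
`≥ 1` (the second copy of the doubled edge). [cite: MadrasSlade1993, §7.1] -/
theorem exists_hasCutAt_succ_cutDouble {n : ℕ} {ω : ℕ → Site d} (h : ∃ s, HasCutAt s n ω) :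
    ∃ s, HasCutAt (s + 1) (n + 1) (cutDouble n ω) := by
  obtain ⟨s, k, -, ⟨hk, he⟩ | ⟨hk, he⟩⟩ := cutDouble_spec h
  · exact ⟨s, k, Or.inl (by rw [he]; exact hk.dblAt_isUpCut_succ)⟩
  · refine ⟨s, k, Or.inr ?_⟩
    rw [he, IsDownCut, neg_neg]
    exact hk.dblAt_isUpCut_succ

/-! ### Prepending a site to a cut-free walk creates no cut edge at positive times -/

/-- If `q` is `ω` shifted by one time step and translated (`q (i + 1) = ω i - z` on `[0, n]`), an
up-cut of `q` at a time `s + 1 ≥ 1` (horizon `n + 1`) is an up-cut of `ω` at time `s` (horizon `n`).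
[cite: MadrasSlade1993, §7.1] -/
private theorem isUpCut_of_shift {q ω : ℕ → Site d} {z : Site d} {k : Fin d} {s n : ℕ}
    (hq : ∀ i ≤ n, q (i + 1) = ω i - z) (h : IsUpCut k (s + 1) (n + 1) q) : IsUpCut k s n ω := by
  obtain ⟨hs, hstep, hpast, hfut⟩ := h
  refine ⟨by omega, ?_, fun i hi => ?_, fun i hi hin => ?_⟩
  · rw [hq (s + 1) (by omega), hq s (by omega)] at hstep
    have := congrArg (fun v => v + z) hstep
    simpa [sub_add_cancel, add_right_comm] using this
  · have := hpast (i + 1) (by omega)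
    rw [hq i (by omega), hq s (by omega), Pi.sub_apply, Pi.sub_apply] at this
    omega
  · have := hfut (i + 1) (by omega) (by omega)
    rw [hq i hin, hq s (by omega), Pi.sub_apply, Pi.sub_apply] at this
    omega

/-- **Prepending a free start site to a CUT-FREE walk creates no strict cut edge at any time `≥ 1`**
(a cut of the prepended walk at time `s + 1` would be a cut of the original walk at time `s`: the
separating hyperplane still separates after the new first site is forgotten). [cite: MadrasSlade1993, §7.1] -/
theorem not_hasCutAt_succ_prependVia {n : ℕ} {ω : ℕ → Site d} (hω : ω ∈ saws d n)
    (hcf : CutFree n ω) (y : Site d) (s : ℕ) : ¬ HasCutAt (s + 1) (n + 1) (prependVia n ω y) := by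
  have hq : ∀ i ≤ n, prependVia n ω y (i + 1) = ω i - (ω n - y) := fun i hi => prependVia_succ hω y hi
  rintro ⟨k, hk | hk⟩
  · exact hcf s ⟨k, Or.inl (isUpCut_of_shift hq hk)⟩
  · refine hcf s ⟨k, Or.inr ?_⟩
    rw [IsDownCut] at hk ⊢
    refine isUpCut_of_shift (q := -prependVia n ω y) (z := -(ω n - y)) (fun i hi => ?_) hk
    rw [Pi.neg_apply, hq i hi, Pi.neg_apply, neg_sub_neg, neg_sub]

/-! ### The two injections have disjoint images -/

open Classical in
/-- **A doubled walk is never an escape image of a cut-free walk.** If `ω₁` has a strict cut edge and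
`ω₂` is cut-free and outside the escape residual, then `cutDouble n ω₁ ≠ escapeMap n ω₂`: a
prolongation of `ω₂` has the cut-free prefix `ω₂`, a doubled walk has not; a prepended `ω₂` has no
cut edge at positive times, a doubled walk has one. [cite: BDGS2012, §1.3] [cite: MadrasSlade1993, §7.1] -/
theorem cutDouble_ne_escapeMap {n : ℕ} {ω₁ ω₂ : ℕ → Site d} (hc₁ : ∃ s, HasCutAt s n ω₁)
    (h₂ : ω₂ ∈ saws d n) (hcf₂ : CutFree n ω₂) (hR₂ : ω₂ ∉ escapeResidual d n) :
    cutDouble n ω₁ ≠ escapeMap n ω₂ := by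
  intro heq
  unfold escapeMap at heq
  split_ifs at heq with hf h'
  · have := not_cutFree_restrictTo_cutDouble hc₁
    rw [heq, restrictTo_extendTo h₂] at this
    exact this hcf₂
  · obtain ⟨s, hs⟩ := exists_hasCutAt_succ_cutDouble hc₁
    rw [heq] at hs
    exact not_hasCutAt_succ_prependVia h₂ hcf₂ _ s hs
  · refine hR₂ (mem_escapeResidual.2 ⟨h₂, hf, ?_⟩)
    rw [extCount, Finset.card_eq_zero]
    exact Finset.not_nonempty_iff_eq_empty.1 h'

/-! ### `cₙ ≤ cₙ₊₁ + #(R ∩ cutFree)` -/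

open Classical in
/-- **`cₙ ≤ cₙ₊₁ + #(escapeResidual d n ∩ cutFree d n)`.**  The map "double the first strict cut edge
if there is one, otherwise apply the escape injection (prolong a free end along an escape route,
else prepend a free start site)" sends the `n`-step self-avoiding walks outside `R ∩ cutFree`
injectively to `(n+1)`-step self-avoiding walks.  So the deficit `cₙ - cₙ₊₁` is at most the number
of CUT-FREE walks with a doomed end and a completely surrounded start.
[cite: BDGS2012, §1.3 (`cₙ ≤ cₙ₊₁`, O'Brien 1990)] [cite: MadrasSlade1993, §7.1] -/
theorem count_le_count_succ_add_card_escapeResidual_inter_cutFree (d n : ℕ) :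
    count d n ≤ count d (n + 1) + (escapeResidual d n ∩ cutFree d n).card := by
  classical
  set E := escapeResidual d n ∩ cutFree d n with hE
  set S := (saws d n).filter fun ω => ω ∉ E with hS
  set Ψ : (ℕ → Site d) → ℕ → Site d := fun ω =>
    if ∃ s, HasCutAt s n ω then cutDouble n ω else escapeMap n ω with hΨ
  -- `cₙ = #S + #E`
  have hsplit : S.card + E.card = count d n := by
    rw [← card_saws d n, hS]
    have h1 := Finset.card_filter_add_card_filter_not (s := saws d n) (fun ω => ω ∉ E)
    have h2 : ((saws d n).filter fun ω => ¬ ω ∉ E) = E := by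
      ext ω
      simp only [Finset.mem_filter, not_not, and_iff_right_iff_imp]
      intro hω
      exact (mem_escapeResidual.1 (Finset.mem_inter.1 hω).1).1
    rw [h2] at h1
    exact h1
  -- a cut-free walk outside `E` is outside the escape residual
  have hout : ∀ {ω}, ω ∈ saws d n → ω ∉ E → (¬ ∃ s, HasCutAt s n ω) →
      CutFree n ω ∧ ω ∉ escapeResidual d n := by
    intro ω hω hωE hc
    have hcf : CutFree n ω := fun s hs => hc ⟨s, hs⟩
    exact ⟨hcf, fun hR => hωE (Finset.mem_inter.2 ⟨hR, mem_cutFree.2 ⟨hω, hcf⟩⟩)⟩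
  -- `Ψ : S ↪ saws d (n+1)`
  have hinj : S.card ≤ (saws d (n + 1)).card := by
    refine Finset.card_le_card_of_injOn Ψ (fun ω hω => ?_) fun ω₁ h₁ ω₂ h₂ heq => ?_
    · obtain ⟨hω, hωE⟩ := Finset.mem_filter.1 hω
      by_cases hc : ∃ s, HasCutAt s n ω
      · simp only [hΨ, if_pos hc]
        exact cutDouble_mem_saws hω hc
      · simp only [hΨ, if_neg hc]
        exact escapeMap_mem_saws hω (hout hω hωE hc).2
    · obtain ⟨hs₁, hE₁⟩ := Finset.mem_filter.1 (Finset.mem_coe.1 h₁)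
      obtain ⟨hs₂, hE₂⟩ := Finset.mem_filter.1 (Finset.mem_coe.1 h₂)
      by_cases hc₁ : ∃ s, HasCutAt s n ω₁ <;> by_cases hc₂ : ∃ s, HasCutAt s n ω₂
      · simp only [hΨ, if_pos hc₁, if_pos hc₂] at heq
        exact cutDouble_injOn n hc₁ hc₂ heq
      · simp only [hΨ, if_pos hc₁, if_neg hc₂] at heq
        obtain ⟨hcf₂, hR₂⟩ := hout hs₂ hE₂ hc₂
        exact (cutDouble_ne_escapeMap hc₁ hs₂ hcf₂ hR₂ heq).elim
      · simp only [hΨ, if_neg hc₁, if_pos hc₂] at heq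
        obtain ⟨hcf₁, hR₁⟩ := hout hs₁ hE₁ hc₁
        exact (cutDouble_ne_escapeMap hc₂ hs₁ hcf₁ hR₁ heq.symm).elim
      · simp only [hΨ, if_neg hc₁, if_neg hc₂] at heq
        obtain ⟨-, hR₁⟩ := hout hs₁ hE₁ hc₁
        obtain ⟨-, hR₂⟩ := hout hs₂ hE₂ hc₂
        exact escapeMap_injOn d n (Finset.mem_coe.2 (Finset.mem_filter.2 ⟨hs₁, hR₁⟩))
          (Finset.mem_coe.2 (Finset.mem_filter.2 ⟨hs₂, hR₂⟩)) heq
  rw [card_saws] at hinj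
  omega

open Classical in
/-- **O'Brien's inequality wherever no walk of the escape residual is cut-free.**
[cite: BDGS2012, §1.3 (`cₙ ≤ cₙ₊₁`, O'Brien 1990)] -/
theorem count_le_count_succ_of_escapeResidual_inter_cutFree_eq_empty {n : ℕ}
    (h : escapeResidual d n ∩ cutFree d n = ∅) : count d n ≤ count d (n + 1) := by
  have := count_le_count_succ_add_card_escapeResidual_inter_cutFree d n
  rw [h, Finset.card_empty, add_zero] at this
  exact this

open Classical in
/-- The combined bound dominates the escape reduction: `#(R ∩ cutFree) ≤ #R`. [cite: BDGS2012, §1.3] -/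
theorem card_escapeResidual_inter_cutFree_le (d n : ℕ) :
    (escapeResidual d n ∩ cutFree d n).card ≤ (escapeResidual d n).card :=
  Finset.card_le_card Finset.inter_subset_left

end Literature.Probability.RandomPlanarGeometry.SAW.Zd

end
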